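import Summits.CriticalPhenomena.CardyFormulaZ2.Theorems.CardyBoundaryCoulombGasBoundaryDefectGaussianRStubRealisabilityPart44

/-!
# Stub `s17_eventually_configsNonempty` of the D2 completion (line
# `rainbow-monomials-in-excursion-kernels`, crux `BoundaryDefectGaussianR`,
# stmt-CriticalPhenomena-14132) — Part 3: following the boundary cycle along a parametrised chain
# of exterior darts; the chains of the three lattice charts

The existence of a height configuration (Part 1: it suffices that the prescribed collar levels be
1-Lipschitz for the cell distance) needs LOCALITY of the boundary cycle `ds = cycle V d₀`: two
cycle darts whose vertices are close in the lattice are close ALONG THE CYCLE, provided `V` carries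
a half-plane / convex / reflex lattice chart of large radius at the first vertex (Part 2:
eventually true at any fixed radius). This part provides the mechanism.

* `lc_follow_fwd`, `lc_follow_bwd`, `lc_locate` — if `γ : ℤ → Dart` is a chain of exterior darts
  with `dsucc (γ i) = γ (i + 1)` on an index window and `ds[s] = γ i₀`, then the cycle follows the
  chain forwards (`ds[(s + m) % P] = γ (i₀ + m)`, by `cycle_succ`) and backwards (by the closure of
  the cycle under exterior predecessors, `cycle_pred_of_dsucc`); so a cycle dart `ds[s'] = γ i'`
  with `|i' - i₀| ≤ M` sits at cyclic offset `|i' - i₀|` from `s` (`cycle_inj`).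
* The chains of the three charts, in a frame `Φ q = o + q.1 • dir K + q.2 • dir (K + 1)`
  (`Φ (q + dir s) = Φ q + dir (K + s)`) in which `V` reads, on a box, as the half-plane `0 ≤ q.2`
  (`lc_H_chain`, `lc_H_exhaust`), the quadrant `0 ≤ q.1 ∧ 0 ≤ q.2` (`lc_Q_chain`, `lc_Q_exhaust`) or
  the co-quadrant `0 ≤ q.2 ∨ q.1 ≤ 0` (`lc_R_chain`, `lc_R_exhaust`): the explicit chain (a straight
  wall; a wall, a convex turn, a wall; a wall, a reflex turn, a wall), its exteriority, its `dsucc`,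
  and EXHAUSTIVENESS — every exterior dart of the box is a chain dart, with an explicit index.
Part 4 assembles the locality lemma. All [folklore].
-/

namespace Summit.CriticalPhenomena.CardyFormulaZ2.Cruxes.BoundaryDefectGaussianR.RainbowMonomialsInExcursionKernels

open Literature.Probability.LatticeModels Literature.Probability.LatticeModels.CollarLegModel

/-! ### Following a chain of exterior darts along the cycle -/

section Follow

variable {V : Finset (ℤ × ℤ)} {d₀ : Dart} (hv₀ : d₀.1 ∈ V) (ht₀ : dartTip d₀ ∉ V)
include hv₀ ht₀

/-- **Following a chain forwards.** If `dsucc (γ i) = γ (i + 1)` for `i₀ ≤ i < i₀ + M` and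
`ds[s] = γ i₀`, then `ds[(s + m) % P] = γ (i₀ + m)` for `m ≤ M`. [folklore] -/
theorem lc_follow_fwd (γ : ℤ → Dart) (i₀ : ℤ) (M : ℕ)
    (hsucc : ∀ i : ℤ, i₀ ≤ i → i < i₀ + M → dsucc V (γ i) = γ (i + 1))
    {s : ℕ} (hs : s < (cycle V d₀).length) (h0 : (cycle V d₀)[s] = γ i₀) :
    ∀ m : ℕ, m ≤ M →
      (cycle V d₀)[(s + m) % (cycle V d₀).length]'(Nat.mod_lt _ (by omega)) = γ (i₀ + m) := by
  intro m
  induction m with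
  | zero =>
    intro _
    rw [getElem_cycle_congr (Nat.mod_lt _ (by omega)) hs (by rw [Nat.add_zero, Nat.mod_eq_of_lt hs]),
      h0]
    simp
  | succ m ih =>
    intro hm
    have hidx : ((s + m) % (cycle V d₀).length + 1) % (cycle V d₀).length =
        (s + (m + 1)) % (cycle V d₀).length := by
      rw [Nat.mod_add_mod, Nat.add_assoc]
    rw [← getElem_cycle_congr (Nat.mod_lt _ (by omega)) (Nat.mod_lt _ (by omega)) hidx,
      cycle_succ hv₀ ht₀ (Nat.mod_lt _ (by omega)), ih (by omega),
      hsucc _ (by omega) (by omega)]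
    congr 1; push_cast; ring

/-- **Following a chain backwards.** If `dsucc (γ i) = γ (i + 1)` and `γ i` is exterior for
`i₀ - M ≤ i < i₀`, and `ds[s] = γ i₀`, then `ds[(s + P M - m) % P] = γ (i₀ - m)` for `m ≤ M` (the
cycle is closed under exterior predecessors). [folklore] -/
theorem lc_follow_bwd (γ : ℤ → Dart) (i₀ : ℤ) (M : ℕ)
    (hsucc : ∀ i : ℤ, i₀ - M ≤ i → i < i₀ → dsucc V (γ i) = γ (i + 1))
    (hext : ∀ i : ℤ, i₀ - M ≤ i → i < i₀ → (γ i).1 ∈ V ∧ dartTip (γ i) ∉ V)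
    {s : ℕ} (hs : s < (cycle V d₀).length) (h0 : (cycle V d₀)[s] = γ i₀) :
    ∀ m : ℕ, m ≤ M →
      (cycle V d₀)[(s + (cycle V d₀).length * M - m) % (cycle V d₀).length]'
        (Nat.mod_lt _ (by omega)) = γ (i₀ - m) := by
  set P := (cycle V d₀).length with hPdef
  have hP : 0 < P := by omega
  intro m
  induction m with
  | zero =>
    intro _
    rw [getElem_cycle_congr (Nat.mod_lt _ hP) hs
      (by rw [Nat.sub_zero, Nat.add_mul_mod_self_left, Nat.mod_eq_of_lt hs]), h0]
    simp
  | succ m ih =>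
    intro hm
    have ih' := ih (by omega)
    have hPM : m + 1 ≤ P * M := le_trans hm (Nat.le_mul_of_pos_left M hP)
    obtain ⟨hev, het⟩ := hext (i₀ - (m + 1 : ℕ)) (by push_cast; omega) (by push_cast; omega)
    have hds : dsucc V (γ (i₀ - (m + 1 : ℕ))) = (cycle V d₀)[(s + P * M - m) % P]'(Nat.mod_lt _ hP) := by
      rw [ih', hsucc _ (by push_cast; omega) (by push_cast; omega)]
      congr 1; push_cast; ring
    obtain ⟨s₁, hs₁, hs₁1, hds₁⟩ := cycle_pred_of_dsucc hv₀ ht₀ hev het (Nat.mod_lt _ hP) hds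
    have hidx : ((s + P * M - (m + 1)) % P + 1) % P = (s + P * M - m) % P := by
      rw [Nat.mod_add_mod, show s + P * M - (m + 1) + 1 = s + P * M - m by omega]
    -- successor indices modulo `P` are injective on `[0, P)`
    have hinj : ∀ {u v : ℕ}, u < P → v < P → (u + 1) % P = (v + 1) % P → u = v := by
      intro u v hu hv h
      rcases Nat.lt_or_ge (u + 1) P with hu1 | hu1 <;> rcases Nat.lt_or_ge (v + 1) P with hv1 | hv1
      · rw [Nat.mod_eq_of_lt hu1, Nat.mod_eq_of_lt hv1] at h; omega
      · rw [Nat.mod_eq_of_lt hu1, show v + 1 = P by omega, Nat.mod_self] at h; omega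
      · rw [Nat.mod_eq_of_lt hv1, show u + 1 = P by omega, Nat.mod_self] at h; omega
      · omega
    have := hinj hs₁ (Nat.mod_lt _ hP) (hs₁1.trans hidx.symm)
    subst this
    exact hds₁

/-- **Locating a chain dart on the cycle.** With the chain followed `M` steps both ways from
`ds[s] = γ i₀`, a cycle dart `ds[s'] = γ i'`, `|i' - i₀| ≤ M`, is at cyclic offset `m = |i' - i₀|`:
`s' = (s + m) % P` or `s = (s' + m) % P`. [folklore] -/
theorem lc_locate (γ : ℤ → Dart) (i₀ : ℤ) (M : ℕ)
    (hsucc : ∀ i : ℤ, i₀ - M ≤ i → i < i₀ + M → dsucc V (γ i) = γ (i + 1))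
    (hext : ∀ i : ℤ, i₀ - M ≤ i → i < i₀ → (γ i).1 ∈ V ∧ dartTip (γ i) ∉ V)
    {s : ℕ} (hs : s < (cycle V d₀).length) (h0 : (cycle V d₀)[s] = γ i₀)
    {s' : ℕ} (hs' : s' < (cycle V d₀).length) {i' : ℤ} (h1 : i₀ - M ≤ i') (h2 : i' ≤ i₀ + M)
    (h' : (cycle V d₀)[s'] = γ i') :
    ∃ m : ℕ, m ≤ M ∧ (i' = i₀ + m ∨ i' = i₀ - m) ∧
      (s' = (s + m) % (cycle V d₀).length ∨ s = (s' + m) % (cycle V d₀).length) := by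
  set P := (cycle V d₀).length with hPdef
  have hP : 0 < P := by omega
  rcases le_or_gt i₀ i' with hle | hlt
  · refine ⟨(i' - i₀).toNat, by omega, Or.inl (by omega), Or.inl ?_⟩
    have hf := lc_follow_fwd hv₀ ht₀ γ i₀ M (fun i hi1 hi2 => hsucc i (by omega) hi2) hs h0
      (i' - i₀).toNat (by omega)
    rw [show i₀ + ((i' - i₀).toNat : ℕ) = i' by omega, ← h'] at hf
    exact (cycle_inj hv₀ ht₀ hf).symm
  · refine ⟨(i₀ - i').toNat, by omega, Or.inr (by omega), Or.inr ?_⟩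
    have hb := lc_follow_bwd hv₀ ht₀ γ i₀ M (fun i hi1 hi2 => hsucc i hi1 (by omega)) hext hs h0
      (i₀ - i').toNat (by omega)
    rw [show i₀ - ((i₀ - i').toNat : ℕ) = i' by omega, ← h'] at hb
    have e1 : (s + P * M - (i₀ - i').toNat) % P = s' := cycle_inj hv₀ ht₀ hb
    have hPM : (i₀ - i').toNat ≤ P * M := le_trans (by omega) (Nat.le_mul_of_pos_left M hP)
    rw [← e1, Nat.mod_add_mod, show s + P * M - (i₀ - i').toNat + (i₀ - i').toNat = s + P * M by omega,
      Nat.add_mul_mod_self_left, Nat.mod_eq_of_lt hs]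

end Follow

/-! ### `Fin 4` bookkeeping -/

/-- Direction arithmetic used along the chains. [folklore] -/
theorem lc_fin4 (K : Fin 4) : K + 3 + 1 = K + 0 ∧ K + 2 + 1 = K + 3 ∧ K + 0 + 1 = K + 1 ∧
    K + 0 + 3 = K + 3 ∧ K + 1 + 0 = K + 1 := by
  revert K; decide

/-- The relative direction: every `k` is `K + r`. [folklore] -/
theorem lc_rel_dir (K k : Fin 4) : ∃ r : Fin 4, k = K + r := ⟨k - K, by abel⟩

/-- The four unit vectors in coordinates. [folklore] -/
theorem lc_dir_val : dir 0 = ((1 : ℤ), (0 : ℤ)) ∧ dir 1 = ((0 : ℤ), (1 : ℤ)) ∧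
    dir 2 = ((-1 : ℤ), (0 : ℤ)) ∧ dir 3 = ((0 : ℤ), (-1 : ℤ)) := by
  refine ⟨?_, ?_, ?_, ?_⟩ <;> rfl

/-! ### The chains of the three charts, in a frame -/

section Chains

variable {V : Finset (ℤ × ℤ)} {Φ : ℤ × ℤ → ℤ × ℤ} {K : Fin 4}
  (hΦ : ∀ (q : ℤ × ℤ) (s : Fin 4), Φ q + dir (K + s) = Φ (q + dir s)) {lo₁ hi₁ lo₂ hi₂ : ℤ}
include hΦ

/-- **Half-plane chart: the chain.** If `Φ q ∈ V ↔ 0 ≤ q.2` on the box, the darts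
`γ i = (Φ (i, 0), K + 3)` are exterior and `dsucc (γ i) = γ (i + 1)` (inside the box). [folklore] -/
theorem lc_H_chain
    (hW : ∀ q : ℤ × ℤ, lo₁ ≤ q.1 → q.1 ≤ hi₁ → lo₂ ≤ q.2 → q.2 ≤ hi₂ → (Φ q ∈ V ↔ 0 ≤ q.2))
    (hlo₂ : lo₂ ≤ -1) (hhi₂ : 0 ≤ hi₂) (i : ℤ) (h1 : lo₁ ≤ i) (h2 : i + 1 ≤ hi₁) :
    ((Φ (i, 0), K + 3) : Dart).1 ∈ V ∧ dartTip ((Φ (i, 0), K + 3) : Dart) ∉ V ∧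
      dsucc V (Φ (i, 0), K + 3) = (Φ (i + 1, 0), K + 3) := by
  obtain ⟨e1, -, -, -, -⟩ := lc_fin4 K
  obtain ⟨d0, -, -, d3⟩ := lc_dir_val
  have m0 : Φ (i, 0) ∈ V := (hW (i, 0) h1 (by omega) (by omega) (by simp; omega)).2 le_rfl
  have m1 : Φ (i, 0) + dir (K + 3) ∉ V := by
    rw [hΦ, d3]
    exact fun h => absurd ((hW _ (by simp; omega) (by simp; omega) (by simp; omega)
      (by simp; omega)).1 h) (by simp)
  have m2 : Φ (i, 0) + dir (K + 3 + 1) ∈ V := by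
    rw [e1, hΦ, d0]
    exact (hW _ (by simp; omega) (by simp; omega) (by simp; omega) (by simp; omega)).2 (by simp)
  have m3 : Φ (i, 0) + dir (K + 3 + 1) + dir (K + 3) ∉ V := by
    rw [e1, hΦ, hΦ, d0, d3]
    exact fun h => absurd ((hW _ (by simp; omega) (by simp; omega) (by simp; omega)
      (by simp; omega)).1 h) (by simp)
  refine ⟨m0, m1, ?_⟩
  rw [dsucc_straight_rule m2 m3, e1, hΦ, d0]
  congr 2

/-- **Half-plane chart: exhaustiveness.** Every exterior dart of the box is a chain dart:
`(Φ q, K + r)` exterior forces `q.2 = 0` and `r = 3`. [folklore] -/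
theorem lc_H_exhaust
    (hW : ∀ q : ℤ × ℤ, lo₁ ≤ q.1 → q.1 ≤ hi₁ → lo₂ ≤ q.2 → q.2 ≤ hi₂ → (Φ q ∈ V ↔ 0 ≤ q.2))
    (q : ℤ × ℤ) (r : Fin 4) (h1 : lo₁ + 1 ≤ q.1) (h2 : q.1 + 1 ≤ hi₁) (h3 : lo₂ + 1 ≤ q.2)
    (h4 : q.2 + 1 ≤ hi₂) (hin : Φ q ∈ V) (hout : Φ q + dir (K + r) ∉ V) :
    q.2 = 0 ∧ r = 3 := by
  obtain ⟨d0, d1, d2, d3⟩ := lc_dir_val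
  have a0 := (hW q (by omega) (by omega) (by omega) (by omega)).1 hin
  rw [hΦ] at hout
  have a1 : ¬ (0 ≤ (q + dir r).2) := fun h =>
    hout ((hW _ (by fin_cases r <;> simp [d0, d1, d2, d3] <;> omega)
      (by fin_cases r <;> simp [d0, d1, d2, d3] <;> omega)
      (by fin_cases r <;> simp [d0, d1, d2, d3] <;> omega)
      (by fin_cases r <;> simp [d0, d1, d2, d3] <;> omega)).2 h)
  fin_cases r <;> simp [d0, d1, d2, d3] at a1 ⊢ <;> omega

/-- **Convex chart: the chain.** If `Φ q ∈ V ↔ 0 ≤ q.1 ∧ 0 ≤ q.2` on the box, the chain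
`γ i = (Φ (0, -i), K + 2)` (`i ≤ 0`, down the first wall), `γ i = (Φ (i - 1, 0), K + 3)` (`i ≥ 1`,
along the second wall; `γ 0 → γ 1` is the convex turn at the corner) consists of exterior darts
with `dsucc (γ i) = γ (i + 1)`. [folklore] -/
theorem lc_Q_chain
    (hW : ∀ q : ℤ × ℤ, lo₁ ≤ q.1 → q.1 ≤ hi₁ → lo₂ ≤ q.2 → q.2 ≤ hi₂ →
      (Φ q ∈ V ↔ 0 ≤ q.1 ∧ 0 ≤ q.2))
    (hlo₁ : lo₁ ≤ -1) (hlo₂ : lo₂ ≤ -1) (γ : ℤ → Dart)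
    (hγ : ∀ i, γ i = if i ≤ 0 then (Φ (0, -i), K + 2) else (Φ (i - 1, 0), K + 3))
    (i : ℤ) (h1 : -i + 1 ≤ hi₂) (h2 : i + 1 ≤ hi₁) (h3 : 1 ≤ hi₁) (h4 : 1 ≤ hi₂) :
    (γ i).1 ∈ V ∧ dartTip (γ i) ∉ V ∧ dsucc V (γ i) = γ (i + 1) := by
  obtain ⟨e1, e2, -, -, -⟩ := lc_fin4 K
  obtain ⟨d0, d1, d2, d3⟩ := lc_dir_val
  have W : ∀ a b : ℤ, lo₁ ≤ a → a ≤ hi₁ → lo₂ ≤ b → b ≤ hi₂ → (Φ (a, b) ∈ V ↔ 0 ≤ a ∧ 0 ≤ b) :=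
    fun a b ha hb hc hd => hW (a, b) ha hb hc hd
  rcases le_or_gt i 0 with hi | hi
  · -- first wall, or the corner
    rw [hγ i, if_pos hi]
    have m0 : Φ (0, -i) ∈ V := (W 0 (-i) (by omega) (by omega) (by omega) (by omega)).2 ⟨le_rfl, by omega⟩
    have m1 : Φ (0, -i) + dir (K + 2) ∉ V := by
      rw [hΦ, d2]
      exact fun h => absurd ((W _ _ (by simp; omega) (by simp; omega) (by simp; omega)
        (by simp; omega)).1 h) (by simp)
    refine ⟨m0, m1, ?_⟩
    rcases lt_or_eq_of_le hi with hi' | rfl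
    · -- straight down the first wall
      rw [hγ (i + 1), if_pos (by omega)]
      have m2 : Φ (0, -i) + dir (K + 2 + 1) ∈ V := by
        rw [e2, hΦ, d3]
        exact (W _ _ (by simp; omega) (by simp; omega) (by simp; omega) (by simp; omega)).2
          ⟨by simp, by simp; omega⟩
      have m3 : Φ (0, -i) + dir (K + 2 + 1) + dir (K + 2) ∉ V := by
        rw [e2, hΦ, hΦ, d3, d2]
        exact fun h => absurd ((W _ _ (by simp; omega) (by simp; omega) (by simp; omega)
          (by simp; omega)).1 h) (by simp)
      rw [dsucc_straight_rule m2 m3, e2, hΦ, d3]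
      congr 2
      simp; ring
    · -- the convex turn at the corner
      rw [hγ (0 + 1), if_neg (by omega)]
      have m2 : Φ (0, -0) + dir (K + 2 + 1) ∉ V := by
        rw [e2, hΦ, d3]
        exact fun h => absurd ((W _ _ (by simp; omega) (by simp; omega) (by simp; omega)
          (by simp; omega)).1 h) (by simp)
      rw [dsucc_turn m2, e2]
      congr 2
  · -- second wall
    rw [hγ i, if_neg (by omega), hγ (i + 1), if_neg (by omega)]
    have m0 : Φ (i - 1, 0) ∈ V := (W _ _ (by omega) (by omega) (by omega) (by omega)).2 ⟨by omega, le_rfl⟩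
    have m1 : Φ (i - 1, 0) + dir (K + 3) ∉ V := by
      rw [hΦ, d3]
      exact fun h => absurd ((W _ _ (by simp; omega) (by simp; omega) (by simp; omega)
        (by simp; omega)).1 h) (by simp)
    have m2 : Φ (i - 1, 0) + dir (K + 3 + 1) ∈ V := by
      rw [e1, hΦ, d0]
      exact (W _ _ (by simp; omega) (by simp; omega) (by simp; omega) (by simp; omega)).2
        ⟨by simp; omega, by simp⟩
    have m3 : Φ (i - 1, 0) + dir (K + 3 + 1) + dir (K + 3) ∉ V := by
      rw [e1, hΦ, hΦ, d0, d3]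
      exact fun h => absurd ((W _ _ (by simp; omega) (by simp; omega) (by simp; omega)
        (by simp; omega)).1 h) (by simp)
    refine ⟨m0, m1, ?_⟩
    rw [dsucc_straight_rule m2 m3, e1, hΦ, d0]
    congr 2
    simp

/-- **Convex chart: exhaustiveness.** Every exterior dart `(Φ q, K + r)` of the box is a chain dart:
on the first wall (`q.1 = 0`, `0 ≤ q.2`, `r = 2`: index `-q.2`) or on the second (`q.2 = 0`,
`0 ≤ q.1`, `r = 3`: index `q.1 + 1`). [folklore] -/
theorem lc_Q_exhaust
    (hW : ∀ q : ℤ × ℤ, lo₁ ≤ q.1 → q.1 ≤ hi₁ → lo₂ ≤ q.2 → q.2 ≤ hi₂ →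
      (Φ q ∈ V ↔ 0 ≤ q.1 ∧ 0 ≤ q.2))
    (q : ℤ × ℤ) (r : Fin 4) (h1 : lo₁ + 1 ≤ q.1) (h2 : q.1 + 1 ≤ hi₁) (h3 : lo₂ + 1 ≤ q.2)
    (h4 : q.2 + 1 ≤ hi₂) (hin : Φ q ∈ V) (hout : Φ q + dir (K + r) ∉ V) :
    (q.1 = 0 ∧ 0 ≤ q.2 ∧ r = 2) ∨ (q.2 = 0 ∧ 0 ≤ q.1 ∧ r = 3) := by
  obtain ⟨d0, d1, d2, d3⟩ := lc_dir_val
  have a0 := (hW q (by omega) (by omega) (by omega) (by omega)).1 hin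
  rw [hΦ] at hout
  have a1 : ¬ (0 ≤ (q + dir r).1 ∧ 0 ≤ (q + dir r).2) := fun h =>
    hout ((hW _ (by fin_cases r <;> simp [d0, d1, d2, d3] <;> omega)
      (by fin_cases r <;> simp [d0, d1, d2, d3] <;> omega)
      (by fin_cases r <;> simp [d0, d1, d2, d3] <;> omega)
      (by fin_cases r <;> simp [d0, d1, d2, d3] <;> omega)).2 h)
  fin_cases r <;> simp [d0, d1, d2, d3] at a1 ⊢ <;> omega

/-- **Reflex chart: the chain.** If `Φ q ∈ V ↔ 0 ≤ q.2 ∨ q.1 ≤ 0` on the box, the chain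
`γ i = (Φ (0, i - 1), K)` (`i ≤ 0`, up the first wall), `γ i = (Φ (i, 0), K + 3)` (`i ≥ 1`, along
the second wall; `γ 0 → γ 1` is the reflex turn) consists of exterior darts with
`dsucc (γ i) = γ (i + 1)`. [folklore] -/
theorem lc_R_chain
    (hW : ∀ q : ℤ × ℤ, lo₁ ≤ q.1 → q.1 ≤ hi₁ → lo₂ ≤ q.2 → q.2 ≤ hi₂ →
      (Φ q ∈ V ↔ 0 ≤ q.2 ∨ q.1 ≤ 0))
    (hlo₁ : lo₁ ≤ 0) (hhi₂ : 0 ≤ hi₂) (γ : ℤ → Dart)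
    (hγ : ∀ i, γ i = if i ≤ 0 then (Φ (0, i - 1), K + 0) else (Φ (i, 0), K + 3))
    (i : ℤ) (h1 : lo₂ ≤ i - 1) (h2 : i + 1 ≤ hi₁) (h3 : 1 ≤ hi₁) (h4 : lo₂ ≤ -1) :
    (γ i).1 ∈ V ∧ dartTip (γ i) ∉ V ∧ dsucc V (γ i) = γ (i + 1) := by
  obtain ⟨e1, -, e3, e4, -⟩ := lc_fin4 K
  obtain ⟨d0, d1, d2, d3⟩ := lc_dir_val
  have W : ∀ a b : ℤ, lo₁ ≤ a → a ≤ hi₁ → lo₂ ≤ b → b ≤ hi₂ → (Φ (a, b) ∈ V ↔ 0 ≤ b ∨ a ≤ 0) :=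
    fun a b ha hb hc hd => hW (a, b) ha hb hc hd
  rcases le_or_gt i 0 with hi | hi
  · -- first wall, or the corner
    rw [hγ i, if_pos hi]
    have m0 : Φ (0, i - 1) ∈ V := (W 0 (i - 1) (by omega) (by omega) (by omega) (by omega)).2 (Or.inr le_rfl)
    have m1 : Φ (0, i - 1) + dir (K + 0) ∉ V := by
      rw [hΦ, d0]
      exact fun h => absurd ((W _ _ (by simp; omega) (by simp; omega) (by simp; omega)
        (by simp; omega)).1 h) (by simp; omega)
    have m2 : Φ (0, i - 1) + dir (K + 0 + 1) ∈ V := by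
      rw [e3, hΦ, d1]
      exact (W _ _ (by simp; omega) (by simp; omega) (by simp; omega) (by simp; omega)).2
        (Or.inr (by simp))
    refine ⟨m0, m1, ?_⟩
    rcases lt_or_eq_of_le hi with hi' | rfl
    · -- straight up the first wall
      rw [hγ (i + 1), if_pos (by omega)]
      have m3 : Φ (0, i - 1) + dir (K + 0 + 1) + dir (K + 0) ∉ V := by
        rw [e3, hΦ, hΦ, d1, d0]
        exact fun h => absurd ((W _ _ (by simp; omega) (by simp; omega) (by simp; omega)
          (by simp; omega)).1 h) (by simp; omega)
      rw [dsucc_straight_rule m2 m3, e3, hΦ, d1]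
      congr 2
      simp
    · -- the reflex turn at the corner
      rw [hγ (0 + 1), if_neg (by omega)]
      have m3 : Φ (0, 0 - 1) + dir (K + 0 + 1) + dir (K + 0) ∈ V := by
        rw [e3, hΦ, hΦ, d1, d0]
        exact (W _ _ (by simp; omega) (by simp; omega) (by simp; omega) (by simp; omega)).2
          (Or.inl (by simp))
      rw [dsucc_back m2 m3, e3, hΦ, hΦ, d1, d0, e4]
      congr 2
  · -- second wall
    rw [hγ i, if_neg (by omega), hγ (i + 1), if_neg (by omega)]
    have m0 : Φ (i, 0) ∈ V := (W _ _ (by omega) (by omega) (by omega) (by omega)).2 (Or.inl le_rfl)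
    have m1 : Φ (i, 0) + dir (K + 3) ∉ V := by
      rw [hΦ, d3]
      exact fun h => absurd ((W _ _ (by simp; omega) (by simp; omega) (by simp; omega)
        (by simp; omega)).1 h) (by simp; omega)
    have m2 : Φ (i, 0) + dir (K + 3 + 1) ∈ V := by
      rw [e1, hΦ, d0]
      exact (W _ _ (by simp; omega) (by simp; omega) (by simp; omega) (by simp; omega)).2
        (Or.inl (by simp))
    have m3 : Φ (i, 0) + dir (K + 3 + 1) + dir (K + 3) ∉ V := by
      rw [e1, hΦ, hΦ, d0, d3]
      exact fun h => absurd ((W _ _ (by simp; omega) (by simp; omega) (by simp; omega)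
        (by simp; omega)).1 h) (by simp; omega)
    refine ⟨m0, m1, ?_⟩
    rw [dsucc_straight_rule m2 m3, e1, hΦ, d0]
    congr 2

/-- **Reflex chart: exhaustiveness.** Every exterior dart `(Φ q, K + r)` of the box is a chain dart:
on the first wall (`q.1 = 0`, `q.2 ≤ -1`, `r = 0`: index `q.2 + 1`) or on the second (`q.2 = 0`,
`1 ≤ q.1`, `r = 3`: index `q.1`). [folklore] -/
theorem lc_R_exhaust
    (hW : ∀ q : ℤ × ℤ, lo₁ ≤ q.1 → q.1 ≤ hi₁ → lo₂ ≤ q.2 → q.2 ≤ hi₂ →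
      (Φ q ∈ V ↔ 0 ≤ q.2 ∨ q.1 ≤ 0))
    (q : ℤ × ℤ) (r : Fin 4) (h1 : lo₁ + 1 ≤ q.1) (h2 : q.1 + 1 ≤ hi₁) (h3 : lo₂ + 1 ≤ q.2)
    (h4 : q.2 + 1 ≤ hi₂) (hin : Φ q ∈ V) (hout : Φ q + dir (K + r) ∉ V) :
    (q.1 = 0 ∧ q.2 ≤ -1 ∧ r = 0) ∨ (q.2 = 0 ∧ 1 ≤ q.1 ∧ r = 3) := by
  obtain ⟨d0, d1, d2, d3⟩ := lc_dir_val
  have a0 := (hW q (by omega) (by omega) (by omega) (by omega)).1 hin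
  rw [hΦ] at hout
  have a1 : ¬ (0 ≤ (q + dir r).2 ∨ (q + dir r).1 ≤ 0) := fun h =>
    hout ((hW _ (by fin_cases r <;> simp [d0, d1, d2, d3] <;> omega)
      (by fin_cases r <;> simp [d0, d1, d2, d3] <;> omega)
      (by fin_cases r <;> simp [d0, d1, d2, d3] <;> omega)
      (by fin_cases r <;> simp [d0, d1, d2, d3] <;> omega)).2 h)
  fin_cases r <;> simp [d0, d1, d2, d3] at a1 ⊢ <;> omega

end Chains

/-! ### Registered one-line form -/

/-- **Registered sub-goal `s17_configsNonempty_part3`** of `s17_eventually_configsNonempty`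
(stmt-CriticalPhenomena-14132): locating a chain dart on the boundary cycle — if the cycle dart
`ds[s]` is `γ i₀` for a chain `γ` of exterior darts with `dsucc (γ i) = γ (i + 1)` on the window
`[i₀ - M, i₀ + M)`, then any cycle dart `ds[s'] = γ i'` with `|i' - i₀| ≤ M` sits at cyclic offset
`|i' - i₀|` from `s` (one-line form of `lc_locate`). [folklore] -/
theorem s17_configsNonempty_part3 : ∀ (V : Finset (ℤ × ℤ)) (d₀ : Literature.Probability.LatticeModels.CollarLegModel.Dart), d₀.1 ∈ V → Literature.Probability.LatticeModels.CollarLegModel.dartTip d₀ ∉ V → ∀ (γ : ℤ → Literature.Probability.LatticeModels.CollarLegModel.Dart) (i₀ : ℤ) (M : ℕ), (∀ i : ℤ, i₀ - M ≤ i → i < i₀ + M → Literature.Probability.LatticeModels.CollarLegModel.dsucc V (γ i) = γ (i + 1)) → (∀ i : ℤ, i₀ - M ≤ i → i < i₀ → (γ i).1 ∈ V ∧ Literature.Probability.LatticeModels.CollarLegModel.dartTip (γ i) ∉ V) → ∀ (s : ℕ) (hs : s < (Literature.Probability.LatticeModels.CollarLegModel.cycle V d₀).length), (Literature.Probability.LatticeModels.CollarLegModel.cycle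 V d₀)[s] = γ i₀ → ∀ (s' : ℕ) (hs' : s' < (Literature.Probability.LatticeModels.CollarLegModel.cycle V d₀).length) (i' : ℤ), i₀ - M ≤ i' → i' ≤ i₀ + M → (Literature.Probability.LatticeModels.CollarLegModel.cycle V d₀)[s'] = γ i' → ∃ m : ℕ, m ≤ M ∧ (i' = i₀ + m ∨ i' = i₀ - m) ∧ (s' = (s + m) % (Literature.Probability.LatticeModels.CollarLegModel.cycle V d₀).length ∨ s = (s' + m) % (Literature.Probability.LatticeModels.CollarLegModel.cycle V d₀).length) :=
  fun _ _ hv₀ ht₀ γ i₀ M hsucc hext _ hs h0 _ hs' _ h1 h2 h' =>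
    lc_locate hv₀ ht₀ γ i₀ M hsucc hext hs h0 hs' h1 h2 h'

end Summit.CriticalPhenomena.CardyFormulaZ2.Cruxes.BoundaryDefectGaussianR.RainbowMonomialsInExcursionKernels
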